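import Mathlib
import Literature.MathematicalPhysics.QuantumLattice.HubbardSectorPropagatorGram
import Literature.MathematicalPhysics.QuantumLattice.HubbardEffectiveActionCT
import HarnessLib

/-!
# The zero-seed covariance of the Hubbard torus in a counterterm frame is normal: `C^K = normalCovariance (βL² G^K₁₁)`,
# and so are its cutoff pieces `C^K_{>Λ}`, `C^K_{(Λ,Λ']}` (symbols `w^K_Λ·βL²·(iω + e_K)/(ω² + e_K²)`)

Topic `MathematicalPhysics/QuantumLattice`; the counterterm-frame twin of the zero-seed block of
`HubbardSectorPropagatorGram.lean` (`hubbardCovariance_zero_seed`, `hubbardCovAbove_zero_seed`, `hubbardCovSlice_zero_seed`), for the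
carrier of `HubbardEffectiveActionCT.lean` (`hubbardCovarianceCT`, `hubbardCovAboveCT`, `hubbardCovSliceCT`, renormalised band
`e_K = nambuXiCT L μ K`, Benfatto–Giuliani–Mastropietro 2003 (2.6): the Gaussian measure of the counterterm scheme carries `-ik₀ + e(k⃗)`).
The CT objects are the bare ones «at chemical potential `μ + K(p_k⃗)`» label by label, so the bare normal-form lemmas do not transport
globally; the proofs below are the bare proofs with `ξ ↦ e_K`.  With these, the Gram / phase-space / charge machinery of
`HubbardSectorPropagatorGram.lean` and `HubbardSectorPhaseSpaceCount.lean` (`sectorSub_pullback_normalCovariance_apply`,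
`contr_pullback_normalCovariance_eq_inner`, `norm_sq_sectorGramF_le`, …), stated for `normalCovariance p`, applies VERBATIM to the single-slice
covariances `C^K_{>Λ_n} − C^K_{>Λ_{n−1}}` that the multiscale expansion of the KL programme integrates in the frame `K`
(cell gate-hubbard-kl, crux K3 child `KLRegimeEngineV7/V8`, seat hubbard-kl-k3c2-p3).

* `nambuPropagatorCT_zero_seed_apply` — `G^K_{ab}(k) = δ_{ab}(iω + s_a e_K)/(ω² + e_K²)` at `h = 0`;
* `nambuDenCT_zero_seed_neg`, `nambuTwoPointCT_zero_seed`, `hubbardTwoPointCT_zero_seed`;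
* **`hubbardCovarianceCT_zero_seed`**, **`hubbardCovAboveCT_zero_seed`**, **`hubbardCovSliceCT_zero_seed`**.
Everything is proved; no definitions, no named facts. [folklore]

## Sources

G. Benfatto, A. Giuliani, V. Mastropietro, Ann. Henri Poincaré 4 (2003) 137–193, §1.2 (2.6), (2.9)–(2.10)
[`BenfattoGiulianiMastropietro2003`]; Ann. Henri Poincaré 7 (2006) 809–898, §2.1 (2.2)–(2.3), §2.7 (2.66)–(2.67)
[`BenfattoGiulianiMastropietro2006`]; M. Salmhofer, *Renormalization* (1999), §4.2.5 (4.70) [`Salmhofer1999`].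
-/

noncomputable section

namespace Literature.MathematicalPhysics.QuantumLattice

open GrassmannAlgebra Finset Literature.Probability.LatticeModels

section ZeroSeedCT

variable {L M : ℕ} [NeZero L]

omit [NeZero L] in
/-- At zero seed the CT Nambu propagator is diagonal: `G^K_{ab}(k) = δ_{ab} (iω + s_a e_K)/(ω² + e_K²)` (BGM 2003 (2.6): the free propagator of the
renormalised band). [cite: BenfattoGiulianiMastropietro2003, §1.2 The model (2.6)] -/
theorem nambuPropagatorCT_zero_seed_apply (β μ : ℝ) (K : TrigPolyC4v) (k : FreqMomentum L M) (a b : Fin 2) :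
    nambuPropagatorCT L M β μ 0 K k a b =
      if a = b then (Complex.I * matsubaraFreq β M k.1 + nambuSign a * nambuXiCT L μ K k.2) / nambuDenCT L M β μ 0 K k
      else 0 := by
  fin_cases a <;> fin_cases b <;>
    simp [nambuPropagatorCT, Matrix.cons_val', Matrix.cons_val_zero, Matrix.cons_val_fin_one, sub_eq_add_neg]

/-- The CT denominator is even and seed-free at `h = 0`: `den_K(-k) = den_K(k) = ω² + e_K²` (`ε(k⃗) = ε(-k⃗)`, BGM 2003 (2.8c)).
[cite: BenfattoGiulianiMastropietro2003, §1.2 The model (2.8c)] -/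
theorem nambuDenCT_zero_seed_neg (β μ : ℝ) (K : TrigPolyC4v) (k : FreqMomentum L M) :
    nambuDenCT L M β μ 0 K k.neg = nambuDenCT L M β μ 0 K k := by
  simp only [nambuDenCT, FreqMomentum.neg, matsubaraFreq_rev, neg_sq, nambuXiCT_neg, zero_mul]

omit [NeZero L] in
/-- The zero-seed CT Nambu two-point table: `⟨Ψ⁻_{k,a}Ψ⁺_{k',b}⟩ = βL² δ_{kk'} δ_{ab} (iω + s_a e_K)/(ω² + e_K²)` (BGM 2006 (2.3) with the
renormalised band). [cite: BenfattoGiulianiMastropietro2006, §2.1 (2.3)] -/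
theorem nambuTwoPointCT_zero_seed (β μ : ℝ) (K : TrigPolyC4v) (A B : (FreqMomentum L M × Fin 2) × Fin 2) :
    nambuTwoPointCT L M β μ 0 K A B = if A.2 = 1 ∧ B.2 = 0 ∧ A.1 = B.1 then
      ((β * (L : ℝ) ^ 2 : ℝ) : ℂ) * ((Complex.I * matsubaraFreq β M A.1.1.1 + nambuSign A.1.2 * nambuXiCT L μ K A.1.1.2) /
        nambuDenCT L M β μ 0 K A.1.1) else 0 := by
  rw [nambuTwoPointCT]
  by_cases h : A.2 = 1 ∧ B.2 = 0 ∧ A.1.1 = B.1.1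
  · rw [if_pos h, nambuPropagatorCT_zero_seed_apply]
    by_cases hab : A.1.2 = B.1.2
    · rw [if_pos hab, if_pos ⟨h.1, h.2.1, Prod.ext h.2.2 hab⟩]
    · rw [if_neg hab, mul_zero, if_neg (fun h' => hab (congrArg Prod.snd h'.2.2))]
  · rw [if_neg h, if_neg (fun h' => h ⟨h'.1, h'.2.1, congrArg Prod.fst h'.2.2⟩)]

/-- **The zero-seed CT two-point table** `⟨ψ_X ψ_Y⟩₀^K` in the original labels: only `ψ⁻_{kσ}ψ⁺_{kσ}` (value `βL² G^K₁₁(k)`) and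
`ψ⁺_{kσ}ψ⁻_{kσ}` (value `-βL² G^K₁₁(k)`) survive, for both spins. [cite: BenfattoGiulianiMastropietro2003, §1.2 The model (2.6)] -/
theorem hubbardTwoPointCT_zero_seed (β μ : ℝ) (K : TrigPolyC4v) (X Y : HubbardFieldIdx L M) :
    hubbardTwoPointCT L M β μ 0 K X Y = if X.1 = Y.1 then
      (if X.2 = 1 ∧ Y.2 = 0 then 1 else if X.2 = 0 ∧ Y.2 = 1 then -1 else 0) *
        (((β * (L : ℝ) ^ 2 : ℝ) : ℂ) *
          ((Complex.I * matsubaraFreq β M X.1.1.1 + nambuXiCT L μ K X.1.1.2) / nambuDenCT L M β μ 0 K X.1.1))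
      else 0 := by
  obtain ⟨⟨k, σ⟩, c⟩ := X
  obtain ⟨⟨k', σ'⟩, c'⟩ := Y
  have hnegk : k.neg = k'.neg ↔ k = k' :=
    ⟨fun h => by simpa using congrArg FreqMomentum.neg h, fun h => by rw [h]⟩
  have hneg1 : matsubaraFreq β M k.neg.1 = -matsubaraFreq β M k.1 := matsubaraFreq_rev β k.1
  have hneg2 : nambuXiCT L μ K k.neg.2 = nambuXiCT L μ K k.2 := by simp [FreqMomentum.neg, nambuXiCT_neg]
  have hneg1' : matsubaraFreq β M k'.neg.1 = -matsubaraFreq β M k'.1 := matsubaraFreq_rev β k'.1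
  have hneg2' : nambuXiCT L μ K k'.neg.2 = nambuXiCT L μ K k'.2 := by simp [FreqMomentum.neg, nambuXiCT_neg]
  rw [hubbardTwoPointCT, nambuTwoPointCT_zero_seed, nambuTwoPointCT_zero_seed]
  fin_cases σ <;> fin_cases σ'
  · -- `↑↑`: the Nambu relabelling is the identity
    fin_cases c <;> fin_cases c' <;> simp [toNambu, Prod.ext_iff, eq_comm]
    all_goals
      split_ifs with h <;> [(obtain ⟨h1, h2⟩ := h; rw [show k' = k from (Prod.ext h1 h2).symm]); simp]
  · -- `↑↓`
    fin_cases c <;> fin_cases c' <;> simp [toNambu, Prod.ext_iff]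
  · -- `↓↑`
    fin_cases c <;> fin_cases c' <;> simp [toNambu, Prod.ext_iff]
  · -- `↓↓`: momenta reflected, charges flipped, `G₂₂(-k) = -G₁₁(k)`
    fin_cases c <;> fin_cases c' <;>
      simp [toNambu, Prod.ext_iff, Fin.rev, hnegk, eq_comm, hneg1, hneg2, hneg1', hneg2', nambuDenCT_zero_seed_neg]
    all_goals
      split_ifs with h <;>
        [(obtain ⟨h1, h2⟩ := h; (try rw [show k' = k from (Prod.ext h1 h2).symm]); ring); simp]

/-- **The zero-seed CT covariance is normal** with symbol `βL² G^K₁₁(k) = βL² (iω + e_K)/(ω² + e_K²)` for both spins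
(BGM 2003 (2.6): the measure `P(dψ) ∝ exp{-(L²β)⁻¹ Σ (-ik₀ + e(k⃗)) ψ̂⁺ψ̂⁻}`). [cite: BenfattoGiulianiMastropietro2003, §1.2 The model (2.6)] -/
theorem hubbardCovarianceCT_zero_seed (β μ : ℝ) (K : TrigPolyC4v) :
    hubbardCovarianceCT L M β μ 0 K = normalCovariance L M (fun ks =>
      ((β * (L : ℝ) ^ 2 : ℝ) : ℂ) *
        ((Complex.I * matsubaraFreq β M ks.1.1 + nambuXiCT L μ K ks.1.2) / nambuDenCT L M β μ 0 K ks.1)) := by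
  ext X Y
  rw [hubbardCovarianceCT, Matrix.of_apply, hubbardTwoPointCT_zero_seed, normalCovariance_apply]
  by_cases h : X.1 = Y.1
  · rw [if_pos h, if_pos h]
    by_cases hA : X.2 = 1 ∧ Y.2 = 0
    · rw [if_pos hA, if_neg (fun hB => Fin.zero_ne_one (hB.1.symm.trans hA.1)), if_pos hA]
      ring
    · rw [if_neg hA]
      by_cases hB : X.2 = 0 ∧ Y.2 = 1
      · rw [if_pos hB, if_pos hB]
        ring
      · rw [if_neg hB, if_neg hB, if_neg hA]
        ring
  · rw [if_neg h, if_neg h, neg_zero]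

/-- **The zero-seed CT cutoff covariance is normal**: `C^K_{>Λ}` at `h = 0` has symbol `w^K_Λ(k) · βL² G^K₁₁(k)`.
[cite: Salmhofer1999, §4.2.5 (4.70)] -/
theorem hubbardCovAboveCT_zero_seed (β μ : ℝ) (K : TrigPolyC4v) (Λ : ℝ) :
    hubbardCovAboveCT L M β μ 0 K Λ = normalCovariance L M (fun ks => (hubbardCutoffWeightCT L M β μ K Λ ks.1 : ℂ) *
      (((β * (L : ℝ) ^ 2 : ℝ) : ℂ) *
        ((Complex.I * matsubaraFreq β M ks.1.1 + nambuXiCT L μ K ks.1.2) / nambuDenCT L M β μ 0 K ks.1))) := by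
  ext X Y
  rw [normalCovariance_smul_symbol, ← hubbardCovarianceCT_zero_seed, hubbardCovAboveCT, Matrix.of_apply]
  by_cases h : X.1 = Y.1
  · have hk : momentumOf L M Y = momentumOf L M X := by simp only [momentumOf, h]
    rw [hk, momentumOf]
    push_cast
    ring
  · have h0 : hubbardCovarianceCT L M β μ 0 K X Y = 0 := by
      rw [hubbardCovarianceCT_zero_seed, normalCovariance_apply, if_neg h]
    rw [h0, mul_zero, mul_zero]

/-- **The zero-seed CT slice covariance** `C^K_{(Λ,Λ']} = C^K_{>Λ} − C^K_{>Λ'}` is normal with symbol `(w^K_Λ − w^K_{Λ'}) · βL² G^K₁₁`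
— the single-slice covariance of the multiscale expansion in the frame `K` (Salmhofer 1999 (4.70); BGM 2006 (2.12)–(2.14)).
[cite: Salmhofer1999, §4.2.5 (4.70)] -/
theorem hubbardCovSliceCT_zero_seed (β μ : ℝ) (K : TrigPolyC4v) (Λ Λ' : ℝ) :
    hubbardCovSliceCT L M β μ 0 K Λ Λ' = normalCovariance L M (fun ks =>
      ((hubbardCutoffWeightCT L M β μ K Λ ks.1 : ℂ) - (hubbardCutoffWeightCT L M β μ K Λ' ks.1 : ℂ)) *
        (((β * (L : ℝ) ^ 2 : ℝ) : ℂ) *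
          ((Complex.I * matsubaraFreq β M ks.1.1 + nambuXiCT L μ K ks.1.2) / nambuDenCT L M β μ 0 K ks.1))) := by
  rw [hubbardCovSliceCT, hubbardCovAboveCT_zero_seed, hubbardCovAboveCT_zero_seed, ← normalCovariance_sub_symbol]
  congr 1
  funext ks
  ring

end ZeroSeedCT

end Literature.MathematicalPhysics.QuantumLattice

end
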